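import Summits.AtomisticToContinuum.BoseEinsteinCondensation.Theorems.BECDyadicChainingDyadicCoherenceDefectLevelIncrement
import Literature.MathematicalPhysics.QuantumManyBody.BoseGasCatStates
import Literature.MathematicalPhysics.QuantumManyBody.FreeDirichletGap
import Literature.MathematicalPhysics.QuantumManyBody.DyadicCoherentFractionLimit
import HarnessLib

/-!
# Crux `DyadicCoherenceDefect` (stmt-AtomisticToContinuum-13192), line `registered`:
# free-gas Haar bands II — one-body near-minimisers are `L²`-close to the sine product

Supports (does not close) stmt-AtomisticToContinuum-13192. Second of three files (see
`…FreeHaarBandPairings.lean`, `…FreeHaarBand.lean`). The analytic input of the free-gas witness: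

* `pairing_perturbation` — for a normalised `C¹` one-body mode `u` vanishing off `Λ_L` with
  `∫|∇u|² ≤ 3((π/L)² + η)` there is `α ∈ ℂ` with `1 − ε ≤ |α| ≤ 1 + ε` and
  `|⟨dyMode_{k,m}, u⟩ − α⟨dyMode_{k,m}, s⟩| ≤ ε` for every flat cell mode, `s` the normalised sine
  product, `ε = (ηL²/π²)^{1/2}`. Proof: `u` as a one-particle Dirichlet trial state, the free
  Dirichlet gap `3π²/L² ‖u − ⟨s,u⟩s‖² ≤ ∫|∇u|² − 3π²/L²` at `N = 1`
  (`Literature…freeDirichletGap`), transfer `(ℝ³)¹ ≅ ℝ³`, Cauchy–Schwarz on each cell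
  (`|⟨dyMode, f⟩|² ≤ ∫|f|²`), and Minkowski in `L²` for the bounds on `|α|`.

All `[folklore]` over [LSSY2005, Ch. 2].

## References

* [LSSY2005] E. H. Lieb, R. Seiringer, J. P. Solovej, J. Yngvason, *The Mathematics of the Bose Gas
  and its Condensation*, Birkhäuser 2005: §1.2 (1.17) (occupations / one-particle density matrix);
  Ch. 2, (2.3) and the remark after (2.50) (free Dirichlet ground state `∏ sin`, energy `3Nπ²/L²`,
  gap `3π²/L²`).
-/

noncomputable section

namespace Summit.AtomisticToContinuum.BoseEinsteinCondensation.Cruxes.DyadicCoherenceDefect.Birth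

open Filter MeasureTheory
open scoped ENNReal NNReal BigOperators ComplexConjugate
open Literature.MathematicalPhysics.QuantumManyBody.BoseGas
open Summit.AtomisticToContinuum.BoseEinsteinCondensation.Theses

namespace FreeHaarBand

variable {n : ℕ} {L : ℝ}

/-! ### Near-minimising one-body modes are `L²`-close to the sine product (free gap, `N = 1`) -/

/-- **One-body near-minimisers of the free Dirichlet energy are close to the sine product.**
For a normalised `C¹` one-body mode `u` vanishing off `Λ_L` with `∫|∇u|² ≤ 3((π/L)² + η)` there is
`α ∈ ℂ` with `1 − ε ≤ |α| ≤ 1 + ε` and `|⟨dyMode_{k,m}, u⟩ − α ⟨dyMode_{k,m}, s⟩| ≤ ε` for every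
flat cell mode, where `s` is the normalised sine product and `ε = (η L²/π²)^{1/2}` (the free
Dirichlet gap `3π²/L²` at `N = 1`, Cauchy–Schwarz on each cell, Minkowski).
[cite: LSSY2005, Ch. 2, (2.3) and after (2.50)] -/
theorem pairing_perturbation (hL : 0 < L) {u : Space → ℂ} (huC : ContDiff ℝ 1 (oneFun u))
    (hnorm : ∫⁻ Y, (‖oneFun u Y‖₊ : ℝ≥0∞) ^ 2 = 1) (hbox : ∀ x : Space, x ∉ box L → u x = 0)
    {η : ℝ} (hη : 0 ≤ η)
    (hE : rawEnergy 0 (oneFun u) ≤ ENNReal.ofReal (3 * ((Real.pi / L) ^ 2 + η))) :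
    ∃ α : ℂ, ‖α‖ ≤ 1 + Real.sqrt (η * L ^ 2 / Real.pi ^ 2) ∧
      1 - Real.sqrt (η * L ^ 2 / Real.pi ^ 2) ≤ ‖α‖ ∧
      ∀ (k : ℕ) (m : Fin 3 → Fin (2 ^ k)),
        ‖(∫ x, conj (dyMode L k m x) * u x) -
            α * ∫ x, conj (dyMode L k m x) * (box L).indicator (fun x : Space =>
              ∏ q : Fin 3, ((Real.sqrt (2 / L) * Real.sin (Real.pi * x q / L) : ℝ) : ℂ)) x‖ ≤
          Real.sqrt (η * L ^ 2 / Real.pi ^ 2) := by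
  have sq_rpow_half : ∀ x : ℝ≥0∞, (x ^ 2) ^ (1 / 2 : ℝ) = x := fun x => by
    rw [← ENNReal.rpow_natCast, ← ENNReal.rpow_mul]
    norm_num
  set s : Space → ℂ := fun x => (box L).indicator (fun x : Space =>
      ∏ q : Fin 3, ((Real.sqrt (2 / L) * Real.sin (Real.pi * x q / L) : ℝ) : ℂ)) x with hs_def
  set t : ℝ := η * L ^ 2 / Real.pi ^ 2 with ht_def
  have ht0 : 0 ≤ t := by positivity
  set ε : ℝ := Real.sqrt t with hε_def
  have hε0 : 0 ≤ ε := Real.sqrt_nonneg _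
  -- continuity / measurability
  have hu_cont : Continuous u := by
    have : u = oneFun u ∘ fun (x : Space) (_ : Fin 1) => x := rfl
    rw [this]
    exact huC.continuous.comp (continuous_pi fun _ => continuous_id)
  have hu_meas : Measurable u := hu_cont.measurable
  have hp1 : Continuous fun x : Space =>
      ∏ q : Fin 3, ((Real.sqrt (2 / L) * Real.sin (Real.pi * x q / L) : ℝ) : ℂ) := by fun_prop
  have hs_meas : Measurable s := hp1.measurable.indicator (measurableSet_box L)
  have hs_int : Integrable s :=
    (integrable_indicator_iff (measurableSet_box L)).2
      ((hp1.continuousOn.integrableOn_compact (isCompact_closedBall (0 : Space) (2 * L))).mono_set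
        (box_subset_closedBall L))
  have hu_int : Integrable u :=
    hu_cont.integrable_of_hasCompactSupport (HasCompactSupport.intro
      (isCompact_closedBall (0 : Space) (2 * L)) fun x hx => hbox x fun h => hx (box_subset_closedBall L h))
  -- the one-particle trial state
  let Ψ₁ : TrialState 1 L :=
    { ψ := oneFun u
      contDiff := huC
      eq_zero := fun X hX => by
        have h0 : X 0 ∉ box L := fun h => hX fun i => by
          rw [Subsingleton.elim i 0]
          exact h
        exact hbox _ h0
      symm := fun σ X => by
        show u ((X ∘ σ) 0) = u (X 0)
        rw [Function.comp_apply, Subsingleton.elim (σ 0) 0]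
      norm_eq := hnorm }
  have hgap := freeDirichletGap (le_refl 1) hL Ψ₁
  set Ψ₀ : Config 1 → ℂ := (boxN 1 L).indicator (fun X : Config 1 => ∏ i : Fin 1, ∏ k : Fin 3,
      ((Real.sqrt (2 / L) * Real.sin (Real.pi * X i k / L) : ℝ) : ℂ)) with hΨ₀_def
  have hΨ₀ : ∀ X : Config 1, Ψ₀ X = s (X 0) := by
    intro X
    by_cases hX : X ∈ boxN 1 L
    · have h0 : X 0 ∈ box L := hX 0
      rw [hΨ₀_def, Set.indicator_of_mem hX, hs_def]
      simp only [Set.indicator_of_mem h0, Fin.prod_univ_one]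
    · have h0 : X 0 ∉ box L := fun h => hX fun i => by
        rw [Subsingleton.elim i 0]
        exact h
      rw [hΨ₀_def, Set.indicator_of_notMem hX, hs_def]
      simp only [Set.indicator_of_notMem h0]
  set α : ℂ := ∫ Y, conj (Ψ₀ Y) * Ψ₁.ψ Y with hα_def
  have hψ₁ : ∀ X : Config 1, Ψ₁.ψ X = u (X 0) := fun X => rfl
  -- Step 1: the gap inequality gives `D₁ ≤ t`
  set D₁ : ℝ≥0∞ := ∫⁻ X, (‖Ψ₁.ψ X - α * Ψ₀ X‖₊ : ℝ≥0∞) ^ 2 with hD₁_def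
  have hc0 : ENNReal.ofReal (3 * Real.pi ^ 2 / L ^ 2) ≠ 0 :=
    (ENNReal.ofReal_pos.2 (by positivity)).ne'
  have hD₁ : D₁ ≤ ENNReal.ofReal t := by
    have h1 : ENNReal.ofReal (3 * Real.pi ^ 2 / L ^ 2) + ENNReal.ofReal (3 * Real.pi ^ 2 / L ^ 2) * D₁ ≤
        ENNReal.ofReal (3 * Real.pi ^ 2 / L ^ 2) + ENNReal.ofReal (3 * η) := by
      have h31 : ENNReal.ofReal (3 * ((1 : ℕ) : ℝ) * Real.pi ^ 2 / L ^ 2) =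
          ENNReal.ofReal (3 * Real.pi ^ 2 / L ^ 2) := by norm_num
      calc ENNReal.ofReal (3 * Real.pi ^ 2 / L ^ 2) + ENNReal.ofReal (3 * Real.pi ^ 2 / L ^ 2) * D₁
          = ENNReal.ofReal (3 * ((1 : ℕ) : ℝ) * Real.pi ^ 2 / L ^ 2) +
              ENNReal.ofReal (3 * Real.pi ^ 2 / L ^ 2) * D₁ := by rw [h31]
        _ ≤ energy 0 Ψ₁ := hgap
        _ ≤ ENNReal.ofReal (3 * ((Real.pi / L) ^ 2 + η)) := by rw [energy_eq_rawEnergy]; exact hE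
        _ = ENNReal.ofReal (3 * Real.pi ^ 2 / L ^ 2) + ENNReal.ofReal (3 * η) := by
            rw [← ENNReal.ofReal_add (by positivity) (by positivity)]
            congr 1
            field_simp
    have h2 : ENNReal.ofReal (3 * Real.pi ^ 2 / L ^ 2) * D₁ ≤ ENNReal.ofReal (3 * η) :=
      (ENNReal.add_le_add_iff_left ENNReal.ofReal_ne_top).1 h1
    calc D₁ ≤ ENNReal.ofReal (3 * η) / ENNReal.ofReal (3 * Real.pi ^ 2 / L ^ 2) := by
          rw [ENNReal.le_div_iff_mul_le (Or.inl hc0) (Or.inl ENNReal.ofReal_ne_top), mul_comm]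
          exact h2
      _ = ENNReal.ofReal t := by
          rw [← ENNReal.ofReal_div_of_pos (by positivity), ht_def]
          congr 1
          field_simp
  -- Step 2: transfer to one-body space
  have hfu : ∀ Y : Config 1, MeasurableEquiv.funUnique (Fin 1) Space Y = Y 0 := fun Y => rfl
  have htr : ∀ g : Space → ℝ≥0∞, ∫⁻ Y : Config 1, g (Y 0) = ∫⁻ x, g x := fun g =>
    (volume_preserving_funUnique (Fin 1) Space).lintegral_comp_emb
      (MeasurableEquiv.funUnique (Fin 1) Space).measurableEmbedding g
  set D : ℝ≥0∞ := ∫⁻ x, (‖u x - α * s x‖₊ : ℝ≥0∞) ^ 2 with hD_def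
  have hDD : D = D₁ := by
    rw [hD_def, ← htr]
    refine lintegral_congr fun Y => ?_
    rw [hψ₁, hΨ₀]
  have hD : D ≤ ENNReal.ofReal t := hDD ▸ hD₁
  have hu1 : ∫⁻ x, (‖u x‖₊ : ℝ≥0∞) ^ 2 = 1 := by
    rw [← htr (fun x => (‖u x‖₊ : ℝ≥0∞) ^ 2)]
    exact hnorm
  have hs1 : ∫⁻ x, (‖s x‖₊ : ℝ≥0∞) ^ 2 = 1 := by
    have h := lintegral_enorm_sq_freeGroundState (N := 1) hL
    rw [← hΨ₀_def] at h
    rw [← htr (fun x => (‖s x‖₊ : ℝ≥0∞) ^ 2), ← h]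
    refine lintegral_congr fun Y => ?_
    rw [hΨ₀ Y, enorm_eq_nnnorm]
  -- Step 3: Minkowski, `1 - ε ≤ |α| ≤ 1 + ε`
  have hDhalf : D ^ (1 / 2 : ℝ) ≤ ENNReal.ofReal ε := by
    calc D ^ (1 / 2 : ℝ) ≤ (ENNReal.ofReal t) ^ (1 / 2 : ℝ) := ENNReal.rpow_le_rpow hD (by norm_num)
      _ = ENNReal.ofReal ε := by
          rw [hε_def, Real.sqrt_eq_rpow, ENNReal.ofReal_rpow_of_nonneg ht0 (by norm_num)]
  have hf_meas : AEMeasurable (fun x => (‖u x - α * s x‖₊ : ℝ≥0∞)) volume :=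
    (hu_meas.sub (hs_meas.const_mul α)).nnnorm.coe_nnreal_ennreal.aemeasurable
  have hg_meas : AEMeasurable (fun x => (‖α * s x‖₊ : ℝ≥0∞)) volume :=
    (hs_meas.const_mul α).nnnorm.coe_nnreal_ennreal.aemeasurable
  have hu_meas' : AEMeasurable (fun x => (‖u x‖₊ : ℝ≥0∞)) volume :=
    hu_meas.nnnorm.coe_nnreal_ennreal.aemeasurable
  have hαs : ∫⁻ x, (‖α * s x‖₊ : ℝ≥0∞) ^ 2 = (‖α‖₊ : ℝ≥0∞) ^ 2 := by
    simp_rw [nnnorm_mul, ENNReal.coe_mul, mul_pow]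
    rw [lintegral_const_mul' _ _ (ENNReal.pow_ne_top ENNReal.coe_ne_top), hs1, mul_one]
  have hM1 : (1 : ℝ≥0∞) ≤ ENNReal.ofReal ε + ‖α‖₊ := by
    have key := ENNReal.lintegral_Lp_add_le hf_meas hg_meas one_le_two
    simp only [Pi.add_apply, ENNReal.rpow_two] at key
    have hle : ∫⁻ x, (‖u x‖₊ : ℝ≥0∞) ^ 2 ≤
        ∫⁻ x, ((‖u x - α * s x‖₊ : ℝ≥0∞) + (‖α * s x‖₊ : ℝ≥0∞)) ^ 2 := by
      refine lintegral_mono fun x => ?_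
      gcongr
      calc (‖u x‖₊ : ℝ≥0∞) = ‖(u x - α * s x) + α * s x‖₊ := by rw [sub_add_cancel]
        _ ≤ _ := by exact_mod_cast nnnorm_add_le _ _
    calc (1 : ℝ≥0∞) = (∫⁻ x, (‖u x‖₊ : ℝ≥0∞) ^ 2) ^ (1 / 2 : ℝ) := by rw [hu1, ENNReal.one_rpow]
      _ ≤ (∫⁻ x, ((‖u x - α * s x‖₊ : ℝ≥0∞) + (‖α * s x‖₊ : ℝ≥0∞)) ^ 2) ^ (1 / 2 : ℝ) :=
          ENNReal.rpow_le_rpow hle (by norm_num)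
      _ ≤ D ^ (1 / 2 : ℝ) + (∫⁻ x, (‖α * s x‖₊ : ℝ≥0∞) ^ 2) ^ (1 / 2 : ℝ) := key
      _ ≤ ENNReal.ofReal ε + ‖α‖₊ := by
          rw [hαs, sq_rpow_half]
          exact add_le_add hDhalf le_rfl
  have hM2 : (‖α‖₊ : ℝ≥0∞) ≤ ENNReal.ofReal ε + 1 := by
    have hf' : AEMeasurable (fun x => (‖α * s x - u x‖₊ : ℝ≥0∞)) volume :=
      ((hs_meas.const_mul α).sub hu_meas).nnnorm.coe_nnreal_ennreal.aemeasurable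
    have key := ENNReal.lintegral_Lp_add_le hf' hu_meas' one_le_two
    simp only [Pi.add_apply, ENNReal.rpow_two] at key
    have hle : ∫⁻ x, (‖α * s x‖₊ : ℝ≥0∞) ^ 2 ≤
        ∫⁻ x, ((‖α * s x - u x‖₊ : ℝ≥0∞) + (‖u x‖₊ : ℝ≥0∞)) ^ 2 := by
      refine lintegral_mono fun x => ?_
      gcongr
      calc (‖α * s x‖₊ : ℝ≥0∞) = ‖(α * s x - u x) + u x‖₊ := by rw [sub_add_cancel]
        _ ≤ _ := by exact_mod_cast nnnorm_add_le _ _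
    have hsymm : ∫⁻ x, (‖α * s x - u x‖₊ : ℝ≥0∞) ^ 2 = D := by
      rw [hD_def]
      refine lintegral_congr fun x => ?_
      rw [← nnnorm_neg, neg_sub]
    calc (‖α‖₊ : ℝ≥0∞) = (∫⁻ x, (‖α * s x‖₊ : ℝ≥0∞) ^ 2) ^ (1 / 2 : ℝ) := by rw [hαs, sq_rpow_half]
      _ ≤ (∫⁻ x, ((‖α * s x - u x‖₊ : ℝ≥0∞) + (‖u x‖₊ : ℝ≥0∞)) ^ 2) ^ (1 / 2 : ℝ) :=
          ENNReal.rpow_le_rpow hle (by norm_num)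
      _ ≤ (∫⁻ x, (‖α * s x - u x‖₊ : ℝ≥0∞) ^ 2) ^ (1 / 2 : ℝ) +
            (∫⁻ x, (‖u x‖₊ : ℝ≥0∞) ^ 2) ^ (1 / 2 : ℝ) := key
      _ ≤ ENNReal.ofReal ε + 1 := by
          rw [hsymm, hu1, ENNReal.one_rpow]
          exact add_le_add hDhalf le_rfl
  -- to real numbers
  have hαr : ((‖α‖₊ : ℝ≥0∞)).toReal = ‖α‖ := by simp
  refine ⟨α, ?_, ?_, fun k m => ?_⟩
  · have h := ENNReal.toReal_mono (by simp) hM2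
    rwa [hαr, ENNReal.toReal_add ENNReal.ofReal_ne_top ENNReal.one_ne_top,
      ENNReal.toReal_ofReal hε0, ENNReal.toReal_one, add_comm] at h
  · have h := ENNReal.toReal_mono (by simp) hM1
    rw [ENNReal.toReal_one, ENNReal.toReal_add ENNReal.ofReal_ne_top ENNReal.coe_ne_top,
      ENNReal.toReal_ofReal hε0, hαr] at h
    linarith
  · -- Step 4: Cauchy–Schwarz on the cell
    have hsk : 0 < L / 2 ^ k := by positivity
    have hIu : IntegrableOn u (dyCell L k m) := hu_int.integrableOn
    have hIs : IntegrableOn (fun x => α * s x) (dyCell L k m) := (hs_int.const_mul α).integrableOn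
    have hsub : (∫ x, conj (dyMode L k m x) * u x) - α * ∫ x, conj (dyMode L k m x) * s x =
        ((Real.sqrt ((L / 2 ^ k) ^ 3))⁻¹ : ℂ) * ∫ x in dyCell L k m, (u x - α * s x) := by
      rw [integral_conj_dyMode_mul, integral_conj_dyMode_mul, integral_sub hIu hIs,
        integral_const_mul]
      ring
    rw [hsub]
    have hf_ae : AEMeasurable (fun x => u x - α * s x) (volume.restrict (dyCell L k m)) :=
      (hu_meas.sub (hs_meas.const_mul α)).aemeasurable
    have hCS := nnnorm_integral_sq_le_mul_lintegral (volume.restrict (dyCell L k m)) hf_ae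
    rw [Measure.restrict_apply_univ, volume_dyCell] at hCS
    have hsq : ((‖((Real.sqrt ((L / 2 ^ k) ^ 3))⁻¹ : ℂ) *
        ∫ x in dyCell L k m, (u x - α * s x)‖₊ : ℝ≥0∞) ^ 2) ≤ ENNReal.ofReal t := by
      rw [nnnorm_mul, ENNReal.coe_mul, mul_pow, nnnorm_flatAmp_sq hsk]
      calc ENNReal.ofReal (((L / 2 ^ k) ^ 3)⁻¹) *
            ((‖∫ x in dyCell L k m, (u x - α * s x)‖₊ : ℝ≥0∞) ^ 2)
          ≤ ENNReal.ofReal (((L / 2 ^ k) ^ 3)⁻¹) * (ENNReal.ofReal (L / 2 ^ k) ^ 3 *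
              ∫⁻ x in dyCell L k m, (‖u x - α * s x‖₊ : ℝ≥0∞) ^ 2) := by gcongr
        _ ≤ ENNReal.ofReal (((L / 2 ^ k) ^ 3)⁻¹) * (ENNReal.ofReal (L / 2 ^ k) ^ 3 * D) := by
            gcongr
            exact setLIntegral_le_lintegral _ _
        _ = D := by
            rw [← mul_assoc, ← ENNReal.ofReal_pow hsk.le, ← ENNReal.ofReal_mul (by positivity),
              inv_mul_cancel₀ (by positivity), ENNReal.ofReal_one, one_mul]
        _ ≤ ENNReal.ofReal t := hD
    rw [nnnorm_coe_sq_eq_ofReal, ENNReal.ofReal_le_ofReal_iff ht0] at hsq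
    rw [← Real.sqrt_sq (norm_nonneg _), hε_def]
    exact Real.sqrt_le_sqrt hsq

end FreeHaarBand

/-- **Helper sub-goal `stub_freePairingPerturbation`** (registered on the crux item so that this file
lands with `--supports`; NOT a skeleton stub — the skeleton's composition is unchanged): one-body
near-minimisers of the free Dirichlet energy are `L²`-close to the ray of the sine product, cell by
cell (`FreeHaarBand.pairing_perturbation`). [cite: LSSY2005, Ch. 2, (2.3) and after (2.50)] -/
theorem stub_freePairingPerturbation :
    ∀ L : ℝ, 0 < L → ∀ u : Space → ℂ, ContDiff ℝ 1 (oneFun u) → (∫⁻ Y, (‖oneFun u Y‖₊ : ℝ≥0∞) ^ 2) = 1 → (∀ x : Space, x ∉ box L → u x = 0) → ∀ η : ℝ, 0 ≤ η → rawEnergy 0 (oneFun u) ≤ ENNReal.ofReal (3 * ((Real.pi / L) ^ 2 + η)) → ∃ α : ℂ, ‖α‖ ≤ 1 + Real.sqrt (η * L ^ 2 / Real.pi ^ 2) ∧ 1 - Real.sqrt (η * L ^ 2 / Real.pi ^ 2) ≤ ‖α‖ ∧ ∀ (k : ℕ) (m : Fin 3 → Fin (2 ^ k)), ‖(∫ x,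 conj (dyMode L k m x) * u x) - α * ∫ x, conj (dyMode L k m x) * (box L).indicator (fun x : Space => ∏ q : Fin 3, ((Real.sqrt (2 / L) * Real.sin (Real.pi * x q / L) : ℝ) : ℂ)) x‖ ≤ Real.sqrt (η * L ^ 2 / Real.pi ^ 2) :=
  fun _ hL _ huC hnorm hbox _ hη hE => FreeHaarBand.pairing_perturbation hL huC hnorm hbox hη hE

end Summit.AtomisticToContinuum.BoseEinsteinCondensation.Cruxes.DyadicCoherenceDefect.Birth

end
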